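import Summits.Ventures.YMGap.Thresholds.StarMassGapSUN
import Summits.Ventures.YMGap.Thresholds.OneLinkVarianceSDCentred
import HarnessLib

/-!
# Venture YMGap — track (a) for `SU(3)`: `ImprovedThreshold 4 3 (77/2000)` HYPOTHESIS-FREE, from the CENTRED Poincaré × Schwinger–Dyson
# modulus `K_PV2` through ds-1's star door; `SU(3)` instances of `K_PV2` at the cell's door radii

HONEST FRAMING: venture file of the cell `pub-ymgap` (QuantumFields programme), seat engine-2 (g10); 0 compute.  Strong-coupling LATTICE
statements for `SU(3)` lattice Yang–Mills on `ℤ⁴` (Wilson action, tree coupling `3·x`, 't Hooft `x = β_W/9`); nothing about the continuum;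
NOT a Yang–Mills mass-gap claim in the Clay sense.  WHAT: the hypothesis-free `SU(3)` threshold of record was `ImprovedThreshold 4 3 (7/200)`
(engine-2 g9, `ImprovedThresholdSU3PV`, g9's modulus `K_PV(3, 21/100) ≤ 50637/20000` in ds-1's star door `4K|x| ≤ 9/25`).  With the centred
modulus of `OneLinkVarianceSDCentred` (`K_PV2(3, 231/1000) ≤ 232383/100000`, `τ = 291/250`; `4 · 2.32383 · 0.0385 = 0.3579 ≤ 9/25`) the same
door gives `ImprovedThreshold 4 3 (77/2000)` (`x₀ = 0.0385`, Wilson `β_W < 0.3465`; `× 1.85` over Shen–Zhu–Zhu's `1/48`).  Also the `SU(3)`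
instances of `K_PV2` consumed by the cell's row files (exact-rational certificates `HOME/pub-ymgap-engine-2/pv2/cert_pv2.json`, each ONE
`norm_num` of `16τ(τ−1) + 9τ³R² ≤ 16(τ−1)K²(1/2−R)`): `R = 1/5`: `2679/1250` (g9 `491/200`); `R = 1/4`: `12251/5000` (g9 `2.886`);
`R = 11/30`: `9289/2500` (g9 `4633/1000`; the CERTIFIED constant given H1 ∧ H2 is `7/5`).  References: Shen–Zhu–Zhu CMP 400 (2023) Thm. 1.2,
Cor. 1.6; the tree: `Thresholds/OneLinkVarianceSDCentred.lean` (engine-2 g10), `Thresholds/StarMassGapSUN.lean` (ds-1),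
`Thresholds/ImprovedThresholdSU3PV.lean` (engine-2 g9).
-/

noncomputable section

open Literature.MathematicalPhysics.QuantumFieldTheory
open Literature.MathematicalPhysics.QuantumFieldTheory.Balaban1983to89.StrongCouplingDobrushinWindow (OneLinkKRModulus)
open Summit.Ventures.YMGap.StarSUNLimit (star_massGapAt_of_oneLinkKRModulus)

namespace Summit.Ventures.YMGap.OneLinkVarianceSDC

/-! ### `SU(3)` instances of the centred modulus -/

/-- `SU(3)`, radius `1/5` (Wilson `β_W = 3/10` at the `d = 4` star/slab radius `2β_W/3`): `OneLinkKRModulus 3 (1/5) (2679/1250)`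
(`K_PV2 = 2.1432`, `τ = 571/500`) — g9's `K_PV` there was `491/200 = 2.455`, Bakry–Émery `10/3`. [folklore] -/
theorem su3_oneLinkKRModulus_pv2_oneFifth : OneLinkKRModulus 3 (1 / 5) (2679 / 1250) :=
  su3_oneLinkKRModulus_pv2_of_le (τ := 571 / 500) (by norm_num) (by norm_num) (by norm_num) (by norm_num)

/-- `SU(3)`, radius `1/4` (Wilson `β_W = 3/8` in `d = 4`, `9/16` in `d = 3`): `OneLinkKRModulus 3 (1/4) (12251/5000)` (`K_PV2 = 2.4502`,
`τ = 1177/1000`) — g9's `K_PV` there was `2.886`, Bakry–Émery `4`. [folklore] -/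
theorem su3_oneLinkKRModulus_pv2_oneQuarter : OneLinkKRModulus 3 (1 / 4) (12251 / 5000) :=
  su3_oneLinkKRModulus_pv2_of_le (τ := 1177 / 1000) (by norm_num) (by norm_num) (by norm_num) (by norm_num)

/-- `SU(3)`, radius `11/30` (the cell's certificate radius; Wilson `β_W = 11/20` in `d = 4`, `33/40` in `d = 3`):
`OneLinkKRModulus 3 (11/30) (9289/2500)` HYPOTHESIS-FREE (`K_PV2 = 3.7156`, `τ = 1241/1000`) — g9's `K_PV` there was `4633/1000`,
Bakry–Émery `15/2`; the CERTIFIED constant (given H1 ∧ H2, not proved in the tree) is `7/5`. [folklore] -/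
theorem su3_oneLinkKRModulus_pv2_elevenThirtieths : OneLinkKRModulus 3 (11 / 30) (9289 / 2500) :=
  su3_oneLinkKRModulus_pv2_of_le (τ := 1241 / 1000) (by norm_num) (by norm_num) (by norm_num) (by norm_num)

/-- `SU(3)`, radius `231/1000` (`= 6 · 77/2000`): `OneLinkKRModulus 3 (231/1000) (232383/100000)` hypothesis-free (`K_PV2 = 2.32383`,
`τ = 291/250`). [folklore] -/
theorem su3_oneLinkKRModulus_pv2_r231 : OneLinkKRModulus 3 (231 / 1000) (232383 / 100000) :=
  su3_oneLinkKRModulus_pv2_of_le (τ := 291 / 250) (by norm_num) (by norm_num) (by norm_num) (by norm_num)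

/-! ### Track (a) -/

/-- **`MassGapAt 4 3 x` at every 't Hooft `|x| ≤ 77/2000`, HYPOTHESIS-FREE** (`SU(3)`, `d = 4`; Wilson `β_W = 9x ≤ 0.3465`): ds-1's star
door on the centred modulus at radius `231/1000 ≥ 6|x|` (`4 · (232383/100000) · (77/2000) = 0.35787 ≤ 9/25`).
[cite: arXiv220412737, Thm. 1.2 and Cor. 1.6] -/
theorem massGapAt_su3_pv2 {x : ℝ} (h : |x| ≤ 77 / 2000) : MassGapAt 4 3 x := by
  have hx0 : 0 ≤ |x| := abs_nonneg x
  refine star_massGapAt_of_oneLinkKRModulus (N := 3) (by norm_num) (K := 232383 / 100000) (R := 231 / 1000) (by norm_num)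
    (by linarith) su3_oneLinkKRModulus_pv2_r231 ?_
  nlinarith

/-- **`ImprovedThreshold 4 3 (77/2000)`, HYPOTHESIS-FREE** (`0.0385 > 1/48`; Wilson `β_W < 0.3465`; the tree's hypothesis-free `SU(3)` record
was `7/200`). [folklore] -/
theorem improvedThreshold_su3_pv2 : ImprovedThreshold 4 3 (77 / 2000) :=
  ⟨by norm_num, fun _ hx => massGapAt_su3_pv2 hx.le⟩

end Summit.Ventures.YMGap.OneLinkVarianceSDC

end
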